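import Summits.ValiantsHypothesis.ValiantsHypothesis.Theorems.SymPencilAffineKernelLever

/-!
# Route `SymPencil` — the affine lever, II: the lever space as a translate of
# `K = {y ∈ im bL : C(v)D⁻¹ y ∈ im bL}` and the two-parameter invariance trick
# (tool file for the size-`27` cells of `sdc(per_4)`, `--supports` stmt-ValiantsHypothesis-5674;
# rung currency only, nothing here bears on `VP ≠ VNP`)

General bookkeeping extracted from the cross-space exclusion
(`SymPencilPerFourCrossSixFront.cross_front`) so that the next candidates of the cell `(10,6,6)`
(`Cruxes/SdcSuperquadratic/PENCIL-CROSS-27.md`: `W_col`, `W₂`, the exotic `V₁`, …) can reuse it.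
With `N = C(v) D⁻¹`, `T_t = (D + t C(v)) D⁻¹ = 1 + t N`, `B = im bL`, `K = B ⊓ N⁻¹ B`:

* `lever_space_eq_map`: for `t ≠ 0`, `B ⊓ T_t B = T_t K` (so all lever spaces have the dimension of
  `K`, `finrank_lever_space_eq`);
* `four_mul_finrank_le_finrank_K`: with the affine lever
  (`SymPencilAffineKernelLever.four_mul_finrank_le_of_affine`), `4 dim B ≤ 2 dim K + |ι'|`;
* `lever_invariance_of_le` (the `t = 1, 2` TRICK): if `T_1 K ≤ B'` and `T_2 K ≤ B'` for a subspace
  `B'` with `dim B' ≤ dim K`, then `K = B'` and `N B' ≤ B'` — the kernel-invariance statement that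
  starts a one-row-type endgame on `B'`.

No definitions, no named facts. [folklore]
-/

noncomputable section

-- single-conjunct layout: Sub = Summit, duplicated namespace component intended
set_option linter.dupNamespace false

namespace Summit.ValiantsHypothesis.ValiantsHypothesis.Theorems.SymPencilAffineKernelLeverInvariance

open Matrix MvPolynomial Module
open Literature.Computability.AlgebraicComplexity
open Summit.ValiantsHypothesis.ValiantsHypothesis.Theorems.SymPencilAffineKernelLever

universe u

variable {k : Type u} [Field k] {ι' : Type*} [Fintype ι'] [DecidableEq ι']

/-- `T_t y = y + t N y` for `T_t = (D + t C) D⁻¹`, `N = C D⁻¹`. [folklore] -/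
theorem translate_apply {D : Matrix ι' ι' k} (hD : IsUnit D.det) (C : Matrix ι' ι' k) (t : k)
    (y : ι' → k) :
    ((D + t • C) * D⁻¹).mulVecLin y = y + t • (C * D⁻¹).mulVecLin y := by
  rw [Matrix.mulVecLin_apply, Matrix.mulVecLin_apply, Matrix.add_mul, Matrix.mul_nonsing_inv _ hD,
    Matrix.smul_mul, Matrix.add_mulVec, Matrix.one_mulVec, Matrix.smul_mulVec]

/-- `T_t` is injective when `D + t C` is invertible. [folklore] -/
theorem translate_injective {D : Matrix ι' ι' k} (hD : IsUnit D.det) (C : Matrix ι' ι' k) (t : k)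
    (ht : IsUnit (D + t • C).det) : Function.Injective ((D + t • C) * D⁻¹).mulVecLin := by
  apply Matrix.mulVec_injective_iff_isUnit.2
  rw [Matrix.isUnit_iff_isUnit_det, Matrix.det_mul]
  exact ht.mul (Matrix.isUnit_nonsing_inv_det_iff.2 hD)

/-- **The lever space is a translate of `K`**: for `t ≠ 0`,
`B ⊓ T_t B = T_t (B ⊓ N⁻¹ B)`. [folklore] -/
theorem lever_space_eq_map {D : Matrix ι' ι' k} (hD : IsUnit D.det) (C : Matrix ι' ι' k)
    (B : Submodule k (ι' → k)) (t : k) (ht : t ≠ 0) :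
    (B ⊓ B.map ((D + t • C) * D⁻¹).mulVecLin : Submodule k (ι' → k)) =
      (B ⊓ B.comap (C * D⁻¹).mulVecLin).map ((D + t • C) * D⁻¹).mulVecLin := by
  ext y
  rw [Submodule.mem_inf, Submodule.mem_map, Submodule.mem_map]
  constructor
  · rintro ⟨hyB, y', hy'B, rfl⟩
    refine ⟨y', Submodule.mem_inf.2 ⟨hy'B, ?_⟩, rfl⟩
    show (C * D⁻¹).mulVecLin y' ∈ B
    have h1 : t • (C * D⁻¹).mulVecLin y' ∈ B := by
      have := B.sub_mem hyB hy'B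
      rwa [translate_apply hD, add_sub_cancel_left] at this
    have := B.smul_mem t⁻¹ h1
    rwa [smul_smul, inv_mul_cancel₀ ht, one_smul] at this
  · rintro ⟨y', hy'K, rfl⟩
    obtain ⟨hy'B, hy'N⟩ := Submodule.mem_inf.1 hy'K
    have hy'N' : (C * D⁻¹).mulVecLin y' ∈ B := hy'N
    refine ⟨?_, y', hy'B, rfl⟩
    rw [translate_apply hD]
    exact B.add_mem hy'B (B.smul_mem t hy'N')

/-- Hence all lever spaces have the dimension of `K`. [folklore] -/
theorem finrank_lever_space_eq {D : Matrix ι' ι' k} (hD : IsUnit D.det) (C : Matrix ι' ι' k)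
    (B : Submodule k (ι' → k)) (t : k) (ht : t ≠ 0) (htu : IsUnit (D + t • C).det) :
    finrank k (B ⊓ B.map ((D + t • C) * D⁻¹).mulVecLin : Submodule k (ι' → k)) =
      finrank k (B ⊓ B.comap (C * D⁻¹).mulVecLin : Submodule k (ι' → k)) := by
  rw [lever_space_eq_map hD C B t ht]
  exact (Submodule.equivMapOfInjective _ (translate_injective hD C t htu) _).finrank_eq.symm

/-- **Dimension of `K`** from the affine lever: `4 dim (im bL) ≤ 2 dim K + |ι'|` (at size `27`
with `dim (im bL) = 10`: `dim K ≥ 7`). [folklore] -/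
theorem four_mul_finrank_le_finrank_K [CharZero k] {D : Matrix ι' ι' k} (hD : IsUnit D.det)
    (hDs : Dᵀ = D)
    (bL : (Fin 4 × Fin 4 → k) →ₗ[k] (ι' → k)) (CL : (Fin 4 × Fin 4 → k) →ₗ[k] Matrix ι' ι' k)
    (hCs : ∀ z, (CL z)ᵀ = CL z) {κ : k} (hκ : κ ≠ 0)
    (hN : ∀ v, bL v = 0 → IsUnit (D + CL v).det ∧ ∀ (z : Fin 4 × Fin 4 → k) (s : k),
      κ * MvPolynomial.eval (v + s • z) (perPoly (Fin 4) k) =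
        (Matrix.fromBlocks ((s * 0) • (1 : Matrix Unit Unit k))
          (Matrix.replicateRow Unit (s • bL z)) (Matrix.replicateCol Unit (s • bL z))
          (D + CL v + s • CL z)).det)
    (v : Fin 4 × Fin 4 → k) (hv : bL v = 0)
    (haff : ∀ z, ∃ e₀ e₁ : k, ∀ s : k,
      MvPolynomial.eval (z + s • v) (perPoly (Fin 4) k) = e₀ + s * e₁) :
    4 * finrank k (LinearMap.range bL) ≤
      2 * finrank k (LinearMap.range bL ⊓ (LinearMap.range bL).comap (CL v * D⁻¹).mulVecLin :
        Submodule k (ι' → k)) + Fintype.card ι' := by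
  have h := four_mul_finrank_le_of_affine hD hDs bL CL hCs hκ hN v hv haff
  have h1 : (D + CL v) * D⁻¹ = (D + (1 : k) • CL v) * D⁻¹ := by rw [one_smul]
  rw [h1, finrank_lever_space_eq hD (CL v) _ 1 one_ne_zero
    (by rw [one_smul]; exact (hN v hv).1)] at h
  exact h

/-- **The `t = 1, 2` trick.**  If the lever spaces at `t = 1` and `t = 2` both lie in a subspace
`B'` of dimension `≤ dim K`, then `K = B'` and `B'` is `N`-invariant. [folklore] -/
theorem lever_invariance_of_le {D : Matrix ι' ι' k} (hD : IsUnit D.det) (C : Matrix ι' ι' k)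
    (B B' : Submodule k (ι' → k))
    (h1 : (B ⊓ B.comap (C * D⁻¹).mulVecLin).map ((D + (1 : k) • C) * D⁻¹).mulVecLin ≤ B')
    (h2 : (B ⊓ B.comap (C * D⁻¹).mulVecLin).map ((D + (2 : k) • C) * D⁻¹).mulVecLin ≤ B')
    (hdim : finrank k B' ≤ finrank k (B ⊓ B.comap (C * D⁻¹).mulVecLin : Submodule k (ι' → k))) :
    (B ⊓ B.comap (C * D⁻¹).mulVecLin : Submodule k (ι' → k)) = B' ∧
      ∀ y ∈ B', (C * D⁻¹).mulVecLin y ∈ B' := by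
  set N := (C * D⁻¹).mulVecLin with hN
  set K := (B ⊓ B.comap N : Submodule k (ι' → k)) with hK
  have hK_le : ∀ y ∈ K, y ∈ B' ∧ N y ∈ B' := by
    intro y hy
    have e1 : y + (1 : k) • N y ∈ B' := h1 ⟨y, hy, translate_apply hD C 1 y⟩
    have e2 : y + (2 : k) • N y ∈ B' := h2 ⟨y, hy, translate_apply hD C 2 y⟩
    rw [one_smul] at e1
    rw [two_smul] at e2
    have hNy : N y ∈ B' := by
      have := B'.sub_mem e2 e1
      rwa [show y + (N y + N y) - (y + N y) = N y by abel] at this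
    refine ⟨?_, hNy⟩
    have := B'.sub_mem e1 hNy
    rwa [add_sub_cancel_right] at this
  have hKB : K = B' := Submodule.eq_of_le_of_finrank_le (fun y hy => (hK_le y hy).1) hdim
  refine ⟨hKB, fun y hy => ?_⟩
  rw [← hKB] at hy
  exact (hK_le y hy).2

end Summit.ValiantsHypothesis.ValiantsHypothesis.Theorems.SymPencilAffineKernelLeverInvariance

end
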